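import Summits.QuantumFields.YangMills.Theorems.AllWindowsColdBoxBulkMidFluxExtensionInterp

/-!
# LINE-18 (crux `AllWindowsColdBox.BulkMidWindowSU2`, ⟨stmt-QuantumFields-24006⟩), toward the gauge-invariant flux maximum
# principle K3″: curvature BOUND for the transfinite extension

With `transfiniteA H ϑ` the Boolean-sum extension of the edge function `ϑ` from the tangential faces of the enlarged box
`{−1,…,2H+1}⁴` (`…BulkMidFluxExtensionInterp`: `A = ϑ` on tangential shell edges, curvature identity
`dA_{ij} = (1 − Q_kQ_l)dϑ_{ij} + (2H+2)⁻¹ Q_kQ_l(D_iϑ_j − D_jϑ_i)`), this file proves `abs_sCirc_transfiniteA_le`: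
if `|dϑ| ≤ ε` on every SHELL plaquette (a plaquette of the enlarged box with a coordinate extremal at all four vertices) and
`|ϑ| ≤ V` on every tangential shell edge, then `|dA| ≤ 3ε + 16V/(2H+2)` on EVERY plaquette of the enlarged box — the
interpolation weights are convex, the flux term sees only shell plaquettes and the value term carries the factor `(2H+2)⁻¹`.

HONEST LABEL: helper toward an UNREGISTERED internal obligation (K3″) of a critic-passed DRAFT line on the R2ξ″ RECORD-rung crux
24006; no stub, crux, rung or summit is proved here; the Yang–Mills mass gap is NOT proved by this file.
-/

set_option autoImplicit false

noncomputable section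

open Finset Function
open Literature.Probability.LatticeModels (Site)
open Literature.MathematicalPhysics.QuantumFieldTheory
open Literature.MathematicalPhysics.QuantumFieldTheory.LatticeMaxwell

namespace Summit.QuantumFields.YangMills.Theorems.AllWindowsColdBoxBulkMidLine.FluxExt

variable {H : ℕ} (ϑ : Literature.MathematicalPhysics.QuantumLattice.ZdEdge 4 → ℝ)

/-! ## Bounds -/

/-- `g − Q_kQ_l g = P_k g + P_l g − P_kP_l g` (the Boolean sum of `P_k`, `P_l`). -/
theorem one_sub_QQ (k l : Fin 4) (g : Site 4 → ℝ) (y : Site 4) :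
    g y - Q H k (Q H l g) y = P H k g y + P H l g y - P H k (P H l g) y := by
  have hl : Q H l g = g - P H l g := rfl
  simp only [Q]
  rw [hl, P_sub, Pi.sub_apply]
  ring

/-- `Q_kQ_l g = g − P_k g − P_l g + P_kP_l g`. -/
theorem QQ_expand (k l : Fin 4) (g : Site 4 → ℝ) (y : Site 4) :
    Q H k (Q H l g) y = g y - P H k g y - P H l g y + P H k (P H l g) y := by
  have := one_sub_QQ (H := H) k l g y
  linarith

/-- `P_k` is a convex combination when `−1 ≤ y_k ≤ 2H+1`. -/
theorem abs_P_le (k : Fin 4) (g : Site 4 → ℝ) {y : Site 4} (hyk : -1 ≤ y k ∧ y k ≤ 2 * (H : ℤ) + 1) {B : ℝ}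
    (h1 : |g (update y k (-1))| ≤ B) (h2 : |g (update y k (2 * (H : ℤ) + 1))| ≤ B) : |P H k g y| ≤ B := by
  have hM : (0 : ℝ) < 2 * H + 2 := by positivity
  have hw1 : 0 ≤ (2 * (H : ℝ) + 1 - (y k : ℝ)) / (2 * H + 2) := by
    apply div_nonneg _ hM.le
    have : ((y k : ℤ) : ℝ) ≤ 2 * (H : ℝ) + 1 := by exact_mod_cast hyk.2
    linarith
  have hw2 : 0 ≤ (((y k : ℤ) : ℝ) + 1) / (2 * H + 2) := by
    apply div_nonneg _ hM.le
    have : (-1 : ℝ) ≤ ((y k : ℤ) : ℝ) := by exact_mod_cast hyk.1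
    linarith
  have hsum : (2 * (H : ℝ) + 1 - (y k : ℝ)) / (2 * H + 2) + (((y k : ℤ) : ℝ) + 1) / (2 * H + 2) = 1 := by
    field_simp; ring
  calc |P H k g y| ≤ (2 * (H : ℝ) + 1 - (y k : ℝ)) / (2 * H + 2) * |g (update y k (-1))| +
        (((y k : ℤ) : ℝ) + 1) / (2 * H + 2) * |g (update y k (2 * (H : ℤ) + 1))| := by
        simp only [P]
        refine (abs_add_le _ _).trans (le_of_eq ?_)
        rw [abs_mul, abs_mul, abs_of_nonneg hw1, abs_of_nonneg hw2]
    _ ≤ (2 * (H : ℝ) + 1 - (y k : ℝ)) / (2 * H + 2) * B + (((y k : ℤ) : ℝ) + 1) / (2 * H + 2) * B := by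
        gcongr
    _ = B := by rw [← add_mul, hsum, one_mul]

/-- Updating a coordinate to an extremal value keeps the point in the enlarged box. -/
theorem range_update {y : Site 4} (hy : ∀ m, -1 ≤ y m ∧ y m ≤ 2 * (H : ℤ) + 1) (k : Fin 4) {s : ℤ}
    (hs : s = -1 ∨ s = 2 * (H : ℤ) + 1) : ∀ m, -1 ≤ update y k s m ∧ update y k s m ≤ 2 * (H : ℤ) + 1 := by
  intro m
  by_cases hm : m = k
  · subst hm; simp only [update_self]; rcases hs with rfl | rfl <;> constructor <;> omega
  · simp only [update_of_ne hm]; exact hy m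

section Bound

variable {ϑ} {ε V : ℝ}
  (hflux : ∀ (z : Site 4) (a b c : Fin 4), a ≠ b → c ≠ a → c ≠ b → (∀ m, -1 ≤ z m ∧ z m ≤ 2 * (H : ℤ) + 1) →
    z a ≤ 2 * (H : ℤ) → z b ≤ 2 * (H : ℤ) → (z c = -1 ∨ z c = 2 * (H : ℤ) + 1) → |sCirc ϑ (z, a, b)| ≤ ε)
  (hval : ∀ (z : Site 4) (a c : Fin 4), c ≠ a → (∀ m, -1 ≤ z m ∧ z m ≤ 2 * (H : ℤ) + 1) → z a ≤ 2 * (H : ℤ) →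
    (z c = -1 ∨ z c = 2 * (H : ℤ) + 1) → |ϑ (z, a)| ≤ V)
include hflux hval

omit hval in
/-- The shell-flux term: `|P_k g|`, `|P_l g|`, `|P_kP_l g| ≤ ε` for `g = dϑ_{ij}` at an admissible base point. -/
theorem abs_P_sCirc_le {y : Site 4} {i j k : Fin 4} (hij : i ≠ j) (hki : k ≠ i) (hkj : k ≠ j)
    (hy : ∀ m, -1 ≤ y m ∧ y m ≤ 2 * (H : ℤ) + 1) (hyi : y i ≤ 2 * (H : ℤ)) (hyj : y j ≤ 2 * (H : ℤ)) :
    |P H k (fun z => sCirc ϑ (z, i, j)) y| ≤ ε := by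
  refine abs_P_le k _ (hy k) ?_ ?_
  · exact hflux _ i j k hij hki hkj (range_update hy k (Or.inl rfl)) (by simpa [update_of_ne hki.symm] using hyi)
      (by simpa [update_of_ne hkj.symm] using hyj) (Or.inl (by simp))
  · exact hflux _ i j k hij hki hkj (range_update hy k (Or.inr rfl)) (by simpa [update_of_ne hki.symm] using hyi)
      (by simpa [update_of_ne hkj.symm] using hyj) (Or.inr (by simp))

omit hval in
/-- The shell-flux term `|P_kP_l dϑ_{ij}| ≤ ε` at an admissible base point. -/
theorem abs_PP_sCirc_le {y : Site 4} {i j k l : Fin 4} (hij : i ≠ j) (hki : k ≠ i) (hkj : k ≠ j) (hli : l ≠ i)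
    (hlj : l ≠ j)
    (hy : ∀ m, -1 ≤ y m ∧ y m ≤ 2 * (H : ℤ) + 1) (hyi : y i ≤ 2 * (H : ℤ)) (hyj : y j ≤ 2 * (H : ℤ)) :
    |P H k (P H l (fun z => sCirc ϑ (z, i, j))) y| ≤ ε := by
  refine abs_P_le k _ (hy k) ?_ ?_ <;>
    refine abs_P_le l _ ((range_update hy k (by simp)) l) ?_ ?_ <;>
    refine hflux _ i j l hij hli hlj (range_update (range_update hy k (by simp)) l (by simp)) ?_ ?_ (by simp) <;>
    simp [update_of_ne hli.symm, update_of_ne hlj.symm, update_of_ne hki.symm, update_of_ne hkj.symm, hyi, hyj]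

omit hflux in
/-- The value term: `|D_iϑ_j − D_jϑ_i| ≤ 4V` at an admissible base point. -/
theorem abs_D_sub_D_le {z : Site 4} {i j : Fin 4} (hij : i ≠ j)
    (hz : ∀ m, -1 ≤ z m ∧ z m ≤ 2 * (H : ℤ) + 1) (hzi : z i ≤ 2 * (H : ℤ)) (hzj : z j ≤ 2 * (H : ℤ)) :
    |(D H i (comp ϑ j) - D H j (comp ϑ i)) z| ≤ 4 * V := by
  simp only [Pi.sub_apply, D, comp]
  have h1 := hval (update z i (2 * (H : ℤ) + 1)) j i hij (range_update hz i (Or.inr rfl))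
    (by simpa [update_of_ne hij.symm] using hzj) (Or.inr (by simp))
  have h2 := hval (update z i (-1)) j i hij (range_update hz i (Or.inl rfl))
    (by simpa [update_of_ne hij.symm] using hzj) (Or.inl (by simp))
  have h3 := hval (update z j (2 * (H : ℤ) + 1)) i j hij.symm (range_update hz j (Or.inr rfl))
    (by simpa [update_of_ne hij] using hzi) (Or.inr (by simp))
  have h4 := hval (update z j (-1)) i j hij.symm (range_update hz j (Or.inl rfl))
    (by simpa [update_of_ne hij] using hzi) (Or.inl (by simp))
  calc |ϑ (update z i (2 * (H : ℤ) + 1), j) - ϑ (update z i (-1), j) -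
        (ϑ (update z j (2 * (H : ℤ) + 1), i) - ϑ (update z j (-1), i))|
      ≤ |ϑ (update z i (2 * (H : ℤ) + 1), j) - ϑ (update z i (-1), j)| +
        |ϑ (update z j (2 * (H : ℤ) + 1), i) - ϑ (update z j (-1), i)| := abs_sub _ _
    _ ≤ (|ϑ (update z i (2 * (H : ℤ) + 1), j)| + |ϑ (update z i (-1), j)|) +
        (|ϑ (update z j (2 * (H : ℤ) + 1), i)| + |ϑ (update z j (-1), i)|) :=
        add_le_add (abs_sub _ _) (abs_sub _ _)
    _ ≤ (V + V) + (V + V) := by gcongr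
    _ = 4 * V := by ring

/-- **Curvature bound for the transfinite extension**: if `|dϑ| ≤ ε` on the shell plaquettes of the enlarged box and
`|ϑ| ≤ V` on its tangential shell edges, then `|dA| ≤ 3ε + 16V/(2H+2)` on every plaquette of the enlarged box. -/
theorem abs_sCirc_transfiniteA_le {y : Site 4} {i j : Fin 4} (hij : i ≠ j)
    (hy : ∀ m, -1 ≤ y m ∧ y m ≤ 2 * (H : ℤ) + 1) (hyi : y i ≤ 2 * (H : ℤ)) (hyj : y j ≤ 2 * (H : ℤ)) :
    |sCirc (transfiniteA H ϑ) (y, i, j)| ≤ 3 * ε + 16 * V / (2 * H + 2) := by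
  obtain ⟨k, l, hki, hkj, hli, hlj, hkl⟩ := exists_other_two hij
  have hM : (0 : ℝ) < 2 * H + 2 := by positivity
  have hQQ := one_sub_QQ (H := H) k l (fun z => sCirc ϑ (z, i, j)) y
  rw [sCirc_transfiniteA_eq ϑ hij hki.symm hli.symm hkj.symm hlj.symm hkl y, hQQ]
  -- the flux term
  have t1 : |P H k (fun z => sCirc ϑ (z, i, j)) y + P H l (fun z => sCirc ϑ (z, i, j)) y -
      P H k (P H l (fun z => sCirc ϑ (z, i, j))) y| ≤ 3 * ε := by
    have a1 := abs_P_sCirc_le hflux hij hki hkj hy hyi hyj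
    have a2 := abs_P_sCirc_le hflux hij hli hlj hy hyi hyj
    have a3 := abs_PP_sCirc_le hflux hij hki hkj hli hlj hy hyi hyj
    calc _ ≤ |P H k (fun z => sCirc ϑ (z, i, j)) y + P H l (fun z => sCirc ϑ (z, i, j)) y| +
          |P H k (P H l (fun z => sCirc ϑ (z, i, j))) y| := abs_sub _ _
      _ ≤ (ε + ε) + ε := add_le_add ((abs_add_le _ _).trans (add_le_add a1 a2)) a3
      _ = 3 * ε := by ring
  -- the value term
  set u : Site 4 → ℝ := D H i (comp ϑ j) - D H j (comp ϑ i) with hu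
  have hu0 : |u y| ≤ 4 * V := abs_D_sub_D_le hval hij hy hyi hyj
  have huk : ∀ s : ℤ, (s = -1 ∨ s = 2 * (H : ℤ) + 1) → |u (update y k s)| ≤ 4 * V := fun s hs =>
    abs_D_sub_D_le hval hij (range_update hy k hs) (by simpa [update_of_ne hki.symm] using hyi)
      (by simpa [update_of_ne hkj.symm] using hyj)
  have hul : ∀ s : ℤ, (s = -1 ∨ s = 2 * (H : ℤ) + 1) → |u (update y l s)| ≤ 4 * V := fun s hs =>
    abs_D_sub_D_le hval hij (range_update hy l hs) (by simpa [update_of_ne hli.symm] using hyi)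
      (by simpa [update_of_ne hlj.symm] using hyj)
  have hukl : ∀ s s' : ℤ, (s = -1 ∨ s = 2 * (H : ℤ) + 1) → (s' = -1 ∨ s' = 2 * (H : ℤ) + 1) →
      |u (update (update y k s) l s')| ≤ 4 * V := fun s s' hs hs' =>
    abs_D_sub_D_le hval hij (range_update (range_update hy k hs) l hs')
      (by simpa [update_of_ne hli.symm, update_of_ne hki.symm] using hyi)
      (by simpa [update_of_ne hlj.symm, update_of_ne hkj.symm] using hyj)
  have pk : |P H k u y| ≤ 4 * V := abs_P_le k u (hy k) (huk _ (Or.inl rfl)) (huk _ (Or.inr rfl))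
  have pl : |P H l u y| ≤ 4 * V := abs_P_le l u (hy l) (hul _ (Or.inl rfl)) (hul _ (Or.inr rfl))
  have pkl : |P H k (P H l u) y| ≤ 4 * V := by
    refine abs_P_le k _ (hy k) ?_ ?_ <;>
      refine abs_P_le l _ ((range_update hy k (by simp)) l) ?_ ?_ <;>
      exact hukl _ _ (by simp) (by simp)
  have t2 : |Q H k (Q H l u) y| ≤ 16 * V := by
    rw [QQ_expand]
    calc _ ≤ |u y - P H k u y - P H l u y| + |P H k (P H l u) y| := abs_add_le _ _
      _ ≤ (|u y - P H k u y| + |P H l u y|) + |P H k (P H l u) y| := by gcongr; exact abs_sub _ _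
      _ ≤ ((|u y| + |P H k u y|) + |P H l u y|) + |P H k (P H l u) y| := by gcongr; exact abs_sub _ _
      _ ≤ ((4 * V + 4 * V) + 4 * V) + 4 * V := by gcongr
      _ = 16 * V := by ring
  calc _ ≤ |P H k (fun z => sCirc ϑ (z, i, j)) y + P H l (fun z => sCirc ϑ (z, i, j)) y -
          P H k (P H l (fun z => sCirc ϑ (z, i, j))) y| + |1 / (2 * (H : ℝ) + 2) * Q H k (Q H l u) y| :=
        abs_add_le _ _
    _ ≤ 3 * ε + 1 / (2 * (H : ℝ) + 2) * (16 * V) := by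
        refine add_le_add t1 ?_
        rw [abs_mul, abs_of_pos (by positivity : (0 : ℝ) < 1 / (2 * H + 2))]
        exact mul_le_mul_of_nonneg_left t2 (by positivity)
    _ = 3 * ε + 16 * V / (2 * H + 2) := by ring

end Bound

end Summit.QuantumFields.YangMills.Theorems.AllWindowsColdBoxBulkMidLine.FluxExt

end
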